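import Summits.ValiantsHypothesis.ValiantsHypothesis.Theorems.LacunarySymmetroidMatrixDescartesDefectLaw

/-!
# `MatrixDescartes` (stmt-ValiantsHypothesis-18050, V1) — line «defect» ported (F3): the INTERPOLATION defect law
# (STUB 1 of the line, CLOSED in the workfile) via Lagrange interpolation at `D + 1` arc nodes

HONEST FRAMING.  Helper port (`--supports stmt-ValiantsHypothesis-18050 --as helper`; val-lit port pool, seat val-port-3 g0;
val-lit desk RULING #232 (d); director-valiant g11 R104) of §8 of the crux workfile `Cruxes/MatrixDescartes/Lines/defect.lean`
v2.1 (val-idea-6 g4, LINE 3 «defect»; val-idea-crit-1 VERDICT #25 = PASS, structure + instrument tier, 0 provers),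
token-for-token up to the port notes: namespace out of `Theses.…DefectLine` into `…Theorems.…Defect`; `arc` / `node` /
`refl` and the §1–§4 tools are CITED BY NAME from val-port-1's (DD) `…LacunarySymmetroidMatrixDescartesDefectDefs` and (F1)
`…LacunarySymmetroidMatrixDescartesDefectLaw`; `l1` is `…FiniteSectorHeightDefs.l1` (val-port-2, (D)).  No definitions, no named
facts, nothing admitted.  A near-full-sector HEIGHT instrument: it locates where a violator of a root law must live; it bounds
nothing about the height-free crux `Summit.ValiantsHypothesis.ValiantsHypothesis.Theses.LacunarySymmetroid.MatrixDescartes`,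
does not touch Conjecture B, and does not move `VP ≠ VNP`.

CONTENTS (workfile §8).  `defect_core` (engine of `defectLaw`, node rule abstracted); reflection bookkeeping
`norm_sub_conj_inv`, `norm_sub_refl_mul_sqrt_le`; Jordan node separation `node_sep_lin`; `prod_abs_sub_eq_factorial`; the
Lagrange node bound `exists_node_eval_ge` (a monic `W` of degree `D` has an arc-node value `≥ (2φ/πD)^D·D!/(D+1)`); the
**interpolation defect law** `interpolationDefectLaw`: for real `f` with `f(0) ≠ 0`, `Z` distinct positive roots, defect
`D ≥ 1`, `0 < φ ≤ π/2`, `√|c₀·lc| · (2cos(φ/2))^Z · (2φ/(πD))^D · D!/(D+1) ≤ ‖f‖₁`.  Its `Prop` closure, the linear excess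
law and the rows are (F4) `…LacunarySymmetroidMatrixDescartesDefectInterpolationRows`.
[folklore] Lagrange interpolation (`Lagrange.coeff_eq_sum`), Jordan `Real.mul_le_sin`, `Nat.choose_le_two_pow`; the law is the line's.
-/


-- `Summit.ValiantsHypothesis.ValiantsHypothesis.…` is the tree's mandated single-conjunct layout (Sub = Summit).
set_option linter.dupNamespace false

open Polynomial Finset

namespace Summit.ValiantsHypothesis.ValiantsHypothesis.Theorems.LacunarySymmetroidMatrixDescartes.Defect

open Summit.ValiantsHypothesis.ValiantsHypothesis.Theorems.LacunarySymmetroidMatrixDescartes.FiniteSector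
  (pencil l1 Rrep)

/-- The engine of §4 with the node bound abstracted: any rule producing, for the residual roots `B`, a point
of the arc `|θ−π| ≤ φ` with `c·Π√|β| ≤ Π|z−β|` yields the law with constant `c`. -/
theorem defect_core (f : ℝ[X]) (hf : f ≠ 0) (h0 : f.coeff 0 ≠ 0) (A : Finset ℝ) (hApos : ∀ a ∈ A, 0 < a)
    (hAroot : ∀ a ∈ A, f.IsRoot a) {D : ℕ} (hD : f.natDegree = A.card + D)
    {φ : ℝ} (hφ0 : 0 ≤ φ) (hφπ : φ ≤ Real.pi) {c : ℝ} (hc : 0 ≤ c)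
    (hnode : ∀ B : Multiset ℂ, B.card = D → (∀ β ∈ B, β ≠ 0) →
      ∃ θ : ℝ, |θ - Real.pi| ≤ φ ∧
        c * (B.map (fun γ => Real.sqrt ‖γ‖)).prod ≤ (B.map (fun γ => ‖arc θ - γ‖)).prod) :
    Real.sqrt |f.coeff 0 * f.leadingCoeff| * ((2 * Real.cos (φ / 2)) ^ A.card * c) ≤ l1 f := by
  -- complexification
  set g : ℂ[X] := f.map Complex.ofRealHom with hg
  have hg0 : g ≠ 0 := (Polynomial.map_ne_zero_iff Complex.ofReal_injective).2 hf
  have hgdeg : g.natDegree = f.natDegree := natDegree_map_eq_of_injective Complex.ofReal_injective f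
  have hglc : g.leadingCoeff = (f.leadingCoeff : ℂ) := leadingCoeff_map_of_injective Complex.ofReal_injective f
  have hgc0 : g.coeff 0 = (f.coeff 0 : ℂ) := coeff_map _ _
  set R := g.roots with hR
  have hRcard : R.card = A.card + D := by
    rw [hR, ← (IsAlgClosed.splits g).natDegree_eq_card_roots, hgdeg, hD]
  -- the positive roots sit inside R
  set A' : Multiset ℂ := A.val.map (fun a : ℝ => (a : ℂ)) with hA'
  have hA'le : A' ≤ R := by
    have h1 : A.val ≤ f.roots :=
      (Multiset.le_iff_subset A.nodup).2 (fun a ha => (mem_roots hf).2 (hAroot a ha))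
    have h2 : A.val.map (fun a : ℝ => (a : ℂ)) ≤ f.roots.map (fun a : ℝ => (a : ℂ)) := Multiset.map_le_map h1
    have h3 : f.roots.map (fun a : ℝ => (a : ℂ)) ≤ g.roots := by
      have := map_roots_le (f := Complex.ofRealHom) (p := f) hg0
      simpa using this
    exact h2.trans h3
  obtain ⟨B, hRB⟩ := Multiset.le_iff_exists_add.1 hA'le
  have hBcard : B.card = D := by
    have := congrArg Multiset.card hRB
    rw [Multiset.card_add, hRcard, hA', Multiset.card_map, Finset.card_val] at this
    omega
  -- no residual root vanishes (c₀ ≠ 0)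
  have hBne : ∀ β ∈ B, β ≠ 0 := by
    intro β hβ hβ0
    have hβR : β ∈ R := by rw [hRB]; exact Multiset.mem_add.2 (Or.inr hβ)
    have hroot : g.IsRoot β := (mem_roots hg0).1 hβR
    apply h0
    have : g.coeff 0 = 0 := by
      rw [coeff_zero_eq_eval_zero]
      have h := hroot
      rw [hβ0] at h
      exact h
    rw [hgc0] at this
    exact_mod_cast this
  -- the good node (hypothesis)
  obtain ⟨θ, hθ, hBlow⟩ := hnode B hBcard hBne
  set z := arc θ with hz
  have hz1 : ‖z‖ = 1 := norm_arc _
  -- evaluate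
  have hev : ‖g.eval z‖ = ‖g.leadingCoeff‖ * ((A'.map (fun γ => ‖z - γ‖)).prod * (B.map (fun γ => ‖z - γ‖)).prod) := by
    rw [norm_eval_eq_prod, ← hR, hRB, Multiset.map_add, Multiset.prod_add]
  have hc0 : ‖g.coeff 0‖ = ‖g.leadingCoeff‖ * ((A'.map (fun γ => ‖γ‖)).prod * (B.map (fun γ => ‖γ‖)).prod) := by
    rw [norm_coeff_zero_eq_prod, ← hR, hRB, Multiset.map_add, Multiset.prod_add]
  -- the A-part
  have hAprod : (A'.map (fun γ => ‖z - γ‖)).prod = ∏ a ∈ A, ‖z - (a : ℂ)‖ := by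
    rw [hA', Multiset.map_map]; rfl
  have hAnorm : (A'.map (fun γ => ‖γ‖)).prod = ∏ a ∈ A, a := by
    rw [hA', Multiset.map_map]
    change (A.val.map (fun a : ℝ => ‖(a : ℂ)‖)).prod = ∏ a ∈ A, a
    have : ∀ a ∈ A, ‖(a : ℂ)‖ = a := fun a ha => by
      rw [Complex.norm_real, Real.norm_eq_abs, abs_of_pos (hApos a ha)]
    calc (A.val.map (fun a : ℝ => ‖(a : ℂ)‖)).prod = ∏ a ∈ A, ‖(a : ℂ)‖ := rfl
      _ = ∏ a ∈ A, a := Finset.prod_congr rfl this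
  have hAlow : (2 * Real.cos (φ / 2)) ^ A.card * ∏ a ∈ A, Real.sqrt a ≤ ∏ a ∈ A, ‖z - (a : ℂ)‖ := by
    rw [← Finset.prod_const, ← Finset.prod_mul_distrib]
    refine Finset.prod_le_prod (fun a ha => ?_) (fun a ha => ?_)
    · have : 0 ≤ Real.cos (φ / 2) :=
        Real.cos_nonneg_of_neg_pi_div_two_le_of_le (by linarith [Real.pi_pos]) (by linarith)
      positivity
    · calc 2 * Real.cos (φ / 2) * Real.sqrt a = 2 * Real.sqrt a * Real.cos (φ / 2) := by ring
        _ ≤ ‖z - (a : ℂ)‖ := two_sqrt_mul_cos_le_norm_arc_sub (hApos a ha) hφ0 hφπ hθ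
  -- the square-root bookkeeping: X := ‖lc‖ Π√a Π√‖β‖ has X² = ‖lc‖‖c₀‖ = |a_0 a_N|
  set X := ‖g.leadingCoeff‖ * ((∏ a ∈ A, Real.sqrt a) * (B.map (fun γ => Real.sqrt ‖γ‖)).prod) with hX
  have hX0 : 0 ≤ X := by
    have : 0 ≤ (B.map (fun γ => Real.sqrt ‖γ‖)).prod := multiset_prod_map_nonneg B _ (fun _ _ => Real.sqrt_nonneg _)
    positivity
  have hXsq : X ^ 2 = |f.coeff 0 * f.leadingCoeff| := by
    have h1 : (∏ a ∈ A, Real.sqrt a) ^ 2 = ∏ a ∈ A, a := by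
      rw [← Finset.prod_pow]
      exact Finset.prod_congr rfl (fun a ha => Real.sq_sqrt (hApos a ha).le)
    have h2 : ((B.map (fun γ => Real.sqrt ‖γ‖)).prod) ^ 2 = (B.map (fun γ => ‖γ‖)).prod := by
      rw [← Multiset.prod_map_pow]
      congr 1
      exact Multiset.map_congr rfl (fun γ _ => Real.sq_sqrt (norm_nonneg _))
    have h3 : |f.coeff 0 * f.leadingCoeff| = ‖g.coeff 0‖ * ‖g.leadingCoeff‖ := by
      rw [hgc0, hglc, Complex.norm_real, Complex.norm_real, Real.norm_eq_abs, Real.norm_eq_abs, abs_mul]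
    rw [h3, hc0, hAnorm, hX, mul_pow, mul_pow, h1, h2]
    ring
  have hXroot : Real.sqrt |f.coeff 0 * f.leadingCoeff| = X := by
    rw [← hXsq, Real.sqrt_sq hX0]
  -- assemble
  have hcos0 : 0 ≤ 2 * Real.cos (φ / 2) := by
    have : 0 ≤ Real.cos (φ / 2) :=
      Real.cos_nonneg_of_neg_pi_div_two_le_of_le (by linarith [Real.pi_pos]) (by linarith)
    positivity
  calc Real.sqrt |f.coeff 0 * f.leadingCoeff| * ((2 * Real.cos (φ / 2)) ^ A.card * c)
      = ‖g.leadingCoeff‖ * (((2 * Real.cos (φ / 2)) ^ A.card * ∏ a ∈ A, Real.sqrt a)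
          * (c * (B.map (fun γ => Real.sqrt ‖γ‖)).prod)) := by
        rw [hXroot, hX]; ring
    _ ≤ ‖g.leadingCoeff‖ * ((∏ a ∈ A, ‖z - (a : ℂ)‖) * (B.map (fun γ => ‖z - γ‖)).prod) := by
        refine mul_le_mul_of_nonneg_left (mul_le_mul hAlow hBlow ?_ ?_) (norm_nonneg _)
        · have : 0 ≤ (B.map (fun γ => Real.sqrt ‖γ‖)).prod :=
            multiset_prod_map_nonneg B _ (fun _ _ => Real.sqrt_nonneg _)
          positivity
        · exact Finset.prod_nonneg (fun _ _ => norm_nonneg _)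
    _ = ‖g.eval z‖ := by rw [hev, hAprod]
    _ ≤ l1 f := norm_eval_map_le_l1 f hz1.le

-- `refl β` (reflection of the large roots in the unit circle) is the `refl` of (DD), cited by name.

/-- On the unit circle (`‖z‖ = 1`): `‖z − 1/β̄‖ · ‖β‖ = ‖z − β‖` for `β ≠ 0`. [folklore] -/
theorem norm_sub_conj_inv {z β : ℂ} (hz : ‖z‖ = 1) (hβ : β ≠ 0) :
    ‖z - ((starRingEnd ℂ) β)⁻¹‖ * ‖β‖ = ‖z - β‖ := by
  have hc : (starRingEnd ℂ) β ≠ 0 := by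
    rw [Ne, _root_.map_eq_zero]; exact hβ
  have h1 : (z - ((starRingEnd ℂ) β)⁻¹) * (starRingEnd ℂ) β = z * (starRingEnd ℂ) (β - z) := by
    have hzz : z * (starRingEnd ℂ) z = 1 := by
      rw [Complex.mul_conj', hz]; norm_num
    calc (z - ((starRingEnd ℂ) β)⁻¹) * (starRingEnd ℂ) β = z * (starRingEnd ℂ) β - 1 := by
          rw [sub_mul, inv_mul_cancel₀ hc]
      _ = z * (starRingEnd ℂ) β - z * (starRingEnd ℂ) z := by rw [hzz]
      _ = z * (starRingEnd ℂ) (β - z) := by rw [map_sub]; ring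
  have h2 : ‖(z - ((starRingEnd ℂ) β)⁻¹) * (starRingEnd ℂ) β‖ = ‖z - β‖ := by
    rw [h1, norm_mul, hz, one_mul, Complex.norm_conj, norm_sub_rev]
  rw [← h2, norm_mul, Complex.norm_conj]

/-- On `‖z‖ = 1`: `‖z − refl β‖ · √‖β‖ ≤ ‖z − β‖` for `β ≠ 0` (termwise bound behind the reflected residual factor). [folklore] -/
theorem norm_sub_refl_mul_sqrt_le {z β : ℂ} (hz : ‖z‖ = 1) (hβ : β ≠ 0) :
    ‖z - refl β‖ * Real.sqrt ‖β‖ ≤ ‖z - β‖ := by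
  unfold refl
  split_ifs with h
  · -- small root: √‖β‖ ≤ 1
    have : Real.sqrt ‖β‖ ≤ 1 := by
      rw [show (1:ℝ) = Real.sqrt 1 by simp]; exact Real.sqrt_le_sqrt h
    calc ‖z - β‖ * Real.sqrt ‖β‖ ≤ ‖z - β‖ * 1 := mul_le_mul_of_nonneg_left this (norm_nonneg _)
      _ = ‖z - β‖ := mul_one _
  · -- large root: ‖z − 1/β̄‖·‖β‖ = ‖z−β‖ and √‖β‖ ≤ ‖β‖
    rw [not_le] at h
    have hs : Real.sqrt ‖β‖ ≤ ‖β‖ := by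
      have h1 : 1 ≤ Real.sqrt ‖β‖ := by
        rw [show (1:ℝ) = Real.sqrt 1 by simp]; exact Real.sqrt_le_sqrt h.le
      calc Real.sqrt ‖β‖ = Real.sqrt ‖β‖ * 1 := (mul_one _).symm
        _ ≤ Real.sqrt ‖β‖ * Real.sqrt ‖β‖ := mul_le_mul_of_nonneg_left h1 (Real.sqrt_nonneg _)
        _ = ‖β‖ := Real.mul_self_sqrt (norm_nonneg _)
    calc ‖z - ((starRingEnd ℂ) β)⁻¹‖ * Real.sqrt ‖β‖
        ≤ ‖z - ((starRingEnd ℂ) β)⁻¹‖ * ‖β‖ := mul_le_mul_of_nonneg_left hs (norm_nonneg _)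
      _ = ‖z - β‖ := norm_sub_conj_inv hz hβ

/-- Linear (Jordan) node separation: `‖zᵢ − zⱼ‖ ≥ (4φ/πD)·|i−j|`. -/
theorem node_sep_lin {φ : ℝ} (hφ0 : 0 ≤ φ) (hφ : φ ≤ Real.pi / 2) {D : ℕ} (hD : 1 ≤ D)
    (i j : Fin (D + 1)) :
    4 * φ / (Real.pi * D) * |((i : ℕ) : ℝ) - ((j : ℕ) : ℝ)| ≤ ‖arc (node φ D i) - arc (node φ D j)‖ := by
  rw [norm_arc_sub_arc]
  have hD' : (0 : ℝ) < D := by exact_mod_cast hD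
  have hdiff : (node φ D i - node φ D j) / 2 = φ / D * ((i : ℕ) - (j : ℕ) : ℝ) := by
    simp only [node]; field_simp; ring
  rw [hdiff]
  have hkD : |((i : ℕ) : ℝ) - ((j : ℕ) : ℝ)| ≤ D := by
    have hi : ((i : ℕ) : ℝ) ≤ D := by exact_mod_cast Nat.lt_succ_iff.1 i.isLt
    have hj : ((j : ℕ) : ℝ) ≤ D := by exact_mod_cast Nat.lt_succ_iff.1 j.isLt
    have hi0 : (0 : ℝ) ≤ ((i : ℕ) : ℝ) := by positivity
    have hj0 : (0 : ℝ) ≤ ((j : ℕ) : ℝ) := by positivity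
    rw [abs_le]; constructor <;> linarith
  have hxle : |φ / D * (((i : ℕ) : ℝ) - ((j : ℕ) : ℝ))| ≤ Real.pi / 2 := by
    rw [abs_mul, abs_of_nonneg (by positivity : (0:ℝ) ≤ φ / D)]
    calc φ / D * |((i : ℕ) : ℝ) - ((j : ℕ) : ℝ)| ≤ φ / D * D := mul_le_mul_of_nonneg_left hkD (by positivity)
      _ = φ := div_mul_cancel₀ _ hD'.ne'
      _ ≤ Real.pi / 2 := hφ
  rw [Real.abs_sin_eq_sin_abs_of_abs_le_pi (hxle.trans (by linarith [Real.pi_pos]))]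
  have hj := Real.mul_le_sin (abs_nonneg (φ / D * (((i : ℕ) : ℝ) - ((j : ℕ) : ℝ)))) hxle
  rw [abs_mul, abs_of_nonneg (by positivity : (0:ℝ) ≤ φ / D)] at hj ⊢
  have : 4 * φ / (Real.pi * D) * |((i : ℕ) : ℝ) - ((j : ℕ) : ℝ)|
      = 2 * (2 / Real.pi * (φ / D * |((i : ℕ) : ℝ) - ((j : ℕ) : ℝ)|)) := by
    field_simp
    ring
  rw [this]
  linarith

/-- `Π_{j ≠ i} |i − j| = i!·(D−i)!` over `Fin (D+1)`. -/
theorem prod_abs_sub_eq_factorial (D : ℕ) (i : Fin (D + 1)) :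
    ∏ j ∈ (Finset.univ : Finset (Fin (D + 1))).erase i, |((i : ℕ) : ℝ) - ((j : ℕ) : ℝ)|
      = ((i : ℕ).factorial : ℝ) * ((D - (i : ℕ)).factorial : ℝ) := by
  classical
  set F : ℕ → ℝ := fun j => if j = (i : ℕ) then 1 else |((i : ℕ) : ℝ) - (j : ℝ)| with hF
  have h1 : ∏ j ∈ (Finset.univ : Finset (Fin (D + 1))).erase i, |((i : ℕ) : ℝ) - ((j : ℕ) : ℝ)|
      = ∏ j : Fin (D + 1), F j := by
    rw [← Finset.mul_prod_erase Finset.univ (fun j : Fin (D+1) => F j) (Finset.mem_univ i)]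
    have hFi : F i = 1 := by simp [hF]
    rw [hFi, one_mul]
    refine Finset.prod_congr rfl (fun j hj => ?_)
    have hji : (j : ℕ) ≠ (i : ℕ) := fun h => (Finset.ne_of_mem_erase hj) (Fin.ext h)
    simp [hF, hji]
  rw [h1, Fin.prod_univ_eq_prod_range (fun j => F j) (D + 1)]
  have hi : (i : ℕ) ≤ D := Nat.lt_succ_iff.1 i.isLt
  rw [Finset.range_eq_Ico]
  rw [← Finset.prod_Ico_consecutive F (Nat.zero_le (i : ℕ)) (by omega : (i : ℕ) ≤ D + 1)]
  rw [← Finset.prod_Ico_consecutive F (Nat.le_succ (i : ℕ)) (by omega : (i : ℕ) + 1 ≤ D + 1)]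
  rw [Nat.Ico_succ_singleton, Finset.prod_singleton]
  have hFi : F (i : ℕ) = 1 := by simp [hF]
  rw [hFi, one_mul]
  -- left block = i!
  have hleft : ∏ j ∈ Finset.Ico 0 (i : ℕ), F j = ((i : ℕ).factorial : ℝ) := by
    rw [← Finset.range_eq_Ico]
    have : ∀ j ∈ Finset.range (i : ℕ), F j = ((i : ℕ) : ℝ) - (j : ℝ) := by
      intro j hj
      have hj' : j < (i : ℕ) := Finset.mem_range.1 hj
      have hne : j ≠ (i : ℕ) := by omega
      have hle : (j : ℝ) ≤ ((i : ℕ) : ℝ) := by exact_mod_cast hj'.le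
      simp [hF, hne, abs_of_nonneg (sub_nonneg.2 hle)]
    rw [Finset.prod_congr rfl this]
    have hrefl := Finset.prod_range_reflect (fun j : ℕ => ((j : ℝ) + 1)) (i : ℕ)
    rw [← Finset.prod_range_add_one_eq_factorial, Nat.cast_prod]
    push_cast
    rw [← hrefl]
    refine Finset.prod_congr rfl (fun j hj => ?_)
    have hj' : j < (i : ℕ) := Finset.mem_range.1 hj
    rw [Nat.cast_sub (by omega : j ≤ (i:ℕ) - 1), Nat.cast_sub (by omega : 1 ≤ (i:ℕ))]
    push_cast; ring
  -- right block = (D − i)!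
  have hright : ∏ j ∈ Finset.Ico ((i : ℕ) + 1) (D + 1), F j = ((D - (i : ℕ)).factorial : ℝ) := by
    rw [Finset.prod_Ico_eq_prod_range]
    have hDi : D + 1 - ((i : ℕ) + 1) = D - (i : ℕ) := by omega
    rw [hDi]
    have : ∀ k ∈ Finset.range (D - (i : ℕ)), F ((i : ℕ) + 1 + k) = (k : ℝ) + 1 := by
      intro k hk
      have hne : (i : ℕ) + 1 + k ≠ (i : ℕ) := by omega
      simp only [hF, hne, if_false]
      push_cast
      rw [abs_of_nonpos (by linarith)]
      ring
    rw [Finset.prod_congr rfl this, ← Finset.prod_range_add_one_eq_factorial, Nat.cast_prod]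
    push_cast; rfl
  rw [hleft, hright]

/-- **Lagrange node bound.**  A monic `W : ℂ[X]` of degree `D` takes, at one of the `D+1` arc nodes, a value of
modulus `≥ (2φ/πD)^D·D!/(D+1)`. -/
theorem exists_node_eval_ge {D : ℕ} (hD1 : 1 ≤ D) {φ : ℝ} (hφ0 : 0 < φ) (hφ : φ ≤ Real.pi / 2)
    (W : ℂ[X]) (hW : W.Monic) (hWdeg : W.natDegree = D) :
    ∃ i : Fin (D + 1), (2 * φ / (Real.pi * D)) ^ D * (D.factorial : ℝ) / (D + 1)
      ≤ ‖W.eval (arc (node φ D i))‖ := by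
  classical
  have hD' : (0 : ℝ) < D := by exact_mod_cast hD1
  set v : Fin (D + 1) → ℂ := fun i => arc (node φ D i) with hv
  set M : ℝ := (2 * φ / (Real.pi * D)) ^ D * (D.factorial : ℝ) with hM
  have hM0 : 0 < M := by positivity
  -- injectivity of the nodes
  have hsin0 : 0 < Real.sin (φ / D) := by
    apply Real.sin_pos_of_pos_of_lt_pi (by positivity)
    calc φ / D ≤ φ / 1 := div_le_div_of_nonneg_left hφ0.le one_pos (by exact_mod_cast hD1)
      _ < Real.pi := by rw [div_one]; linarith [Real.pi_pos]
  have hvs : Set.InjOn v (Finset.univ : Finset (Fin (D + 1))) := by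
    intro i _ j _ hij
    by_contra hne
    have := node_sep hφ0.le hφ hD1 i j hne
    rw [hv] at hij
    simp only at hij
    rw [hij, sub_self, norm_zero] at this
    linarith
  -- denominators are large
  have hden : ∀ i : Fin (D + 1), M ≤ ‖∏ j ∈ (Finset.univ : Finset (Fin (D + 1))).erase i, (v i - v j)‖ := by
    intro i
    rw [norm_prod]
    have h1 : ∏ j ∈ (Finset.univ : Finset (Fin (D + 1))).erase i,
        (4 * φ / (Real.pi * D) * |((i : ℕ) : ℝ) - ((j : ℕ) : ℝ)|)
        ≤ ∏ j ∈ (Finset.univ : Finset (Fin (D + 1))).erase i, ‖v i - v j‖ :=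
      Finset.prod_le_prod (fun j _ => by positivity) (fun j _ => node_sep_lin hφ0.le hφ hD1 i j)
    refine le_trans ?_ h1
    rw [Finset.prod_mul_distrib, Finset.prod_const, Finset.card_erase_of_mem (Finset.mem_univ i),
      Finset.card_univ, Fintype.card_fin, Nat.add_sub_cancel, prod_abs_sub_eq_factorial]
    -- M = (2φ/πD)^D D! ≤ (4φ/πD)^D · i!(D−i)!  since C(D,i) ≤ 2^D
    have hchoose : (D.factorial : ℝ) ≤ 2 ^ D * (((i : ℕ).factorial : ℝ) * ((D - (i : ℕ)).factorial : ℝ)) := by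
      have hi : (i : ℕ) ≤ D := Nat.lt_succ_iff.1 i.isLt
      have h := Nat.choose_mul_factorial_mul_factorial hi
      have h2 := Nat.choose_le_two_pow D (i : ℕ)
      have : (D.factorial : ℝ) = (D.choose (i:ℕ) : ℝ) * (((i : ℕ).factorial : ℝ) * ((D - (i : ℕ)).factorial : ℝ)) := by
        rw [← mul_assoc]; exact_mod_cast h.symm
      rw [this]
      refine mul_le_mul_of_nonneg_right (by exact_mod_cast h2) (by positivity)
    calc M = (2 * φ / (Real.pi * D)) ^ D * (D.factorial : ℝ) := rfl
      _ ≤ (2 * φ / (Real.pi * D)) ^ D * (2 ^ D * (((i : ℕ).factorial : ℝ) * ((D - (i : ℕ)).factorial : ℝ))) :=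
          mul_le_mul_of_nonneg_left hchoose (by positivity)
      _ = (4 * φ / (Real.pi * D)) ^ D * (((i : ℕ).factorial : ℝ) * ((D - (i : ℕ)).factorial : ℝ)) := by
          rw [← mul_assoc, ← mul_pow]; congr 2; ring
  -- Lagrange: 1 = lc W = Σ W(vᵢ)/qᵢ
  have hdeg : W.degree < #(Finset.univ : Finset (Fin (D + 1))) := by
    rw [Finset.card_univ, Fintype.card_fin]
    calc W.degree ≤ W.natDegree := degree_le_natDegree
      _ = D := by rw [hWdeg]
      _ < (D + 1 : ℕ) := by exact_mod_cast Nat.lt_succ_self D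
  have hid := Lagrange.coeff_eq_sum hvs hdeg
  rw [Finset.card_univ, Fintype.card_fin, Nat.add_sub_cancel] at hid
  have hcoeff : W.coeff D = 1 := by rw [← hWdeg]; exact hW.coeff_natDegree
  rw [hcoeff] at hid
  -- contradiction if all node values are small
  by_contra hsmall
  simp only [not_exists, not_le] at hsmall
  have hlt : ∀ i : Fin (D + 1),
      ‖W.eval (v i) / ∏ j ∈ (Finset.univ : Finset (Fin (D + 1))).erase i, (v i - v j)‖ < 1 / (D + 1) := by
    intro i
    rw [norm_div]
    have hq : 0 < ‖∏ j ∈ (Finset.univ : Finset (Fin (D + 1))).erase i, (v i - v j)‖ := hM0.trans_le (hden i)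
    rw [div_lt_iff₀ hq]
    calc ‖W.eval (v i)‖ < M / (D + 1) := hsmall i
      _ = 1 / (D + 1) * M := by ring
      _ ≤ 1 / (D + 1) * ‖∏ j ∈ (Finset.univ : Finset (Fin (D + 1))).erase i, (v i - v j)‖ :=
          mul_le_mul_of_nonneg_left (hden i) (by positivity)
  have hsum : ‖∑ i : Fin (D + 1), W.eval (v i) / ∏ j ∈ (Finset.univ : Finset (Fin (D + 1))).erase i, (v i - v j)‖
      < 1 := by
    calc ‖∑ i : Fin (D + 1), W.eval (v i) / ∏ j ∈ (Finset.univ : Finset (Fin (D + 1))).erase i, (v i - v j)‖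
        ≤ ∑ i : Fin (D + 1), ‖W.eval (v i) / ∏ j ∈ (Finset.univ : Finset (Fin (D + 1))).erase i, (v i - v j)‖ :=
          norm_sum_le _ _
      _ < ∑ _i : Fin (D + 1), (1 : ℝ) / (D + 1) :=
          Finset.sum_lt_sum_of_nonempty Finset.univ_nonempty (fun i _ => hlt i)
      _ = 1 := by
          rw [Finset.sum_const, Finset.card_univ, Fintype.card_fin, nsmul_eq_mul]
          push_cast; field_simp
  rw [← hid] at hsum
  simp at hsum

/-- **INTERPOLATION DEFECT LAW (PROVED; closes STUB 1 in the `D+1` form).**  For every real `f` with `f(0) ≠ 0`,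
`Z` distinct positive roots, defect `D ≥ 1` and `0 < φ ≤ π/2`:
`√|c₀·lc| · (2cos(φ/2))^Z · (2φ/(πD))^D · D!/(D+1) ≤ ‖f‖₁` — each wasted root refunds only `log₂(eπ/2φ) + o(1)` bits. -/
theorem interpolationDefectLaw (f : ℝ[X]) (hf : f ≠ 0) (h0 : f.coeff 0 ≠ 0) (A : Finset ℝ)
    (hApos : ∀ a ∈ A, 0 < a) (hAroot : ∀ a ∈ A, f.IsRoot a) {D : ℕ} (hD : f.natDegree = A.card + D)
    (hD1 : 1 ≤ D) {φ : ℝ} (hφ0 : 0 < φ) (hφ : φ ≤ Real.pi / 2) :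
    Real.sqrt |f.coeff 0 * f.leadingCoeff| * ((2 * Real.cos (φ / 2)) ^ A.card
      * ((2 * φ / (Real.pi * D)) ^ D * (D.factorial : ℝ) / (D + 1))) ≤ l1 f := by
  classical
  refine defect_core f hf h0 A hApos hAroot hD hφ0.le (by linarith [Real.pi_pos]) (by positivity) ?_
  intro B hBcard hBne
  -- W := Π_B (X − refl β), monic of degree D
  set W : ℂ[X] := (B.map (fun β => X - C (refl β))).prod with hWdef
  have hWmonic : W.Monic := monic_multiset_prod_of_monic B (fun β => X - C (refl β)) (fun β _ => monic_X_sub_C _)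
  have hWdeg : W.natDegree = D := by
    rw [hWdef, natDegree_multiset_prod_of_monic _ (fun p hp => by
      obtain ⟨β, _, rfl⟩ := Multiset.mem_map.1 hp; exact monic_X_sub_C _)]
    rw [Multiset.map_map]
    have : (B.map (natDegree ∘ fun β => X - C (refl β))) = B.map (fun _ => 1) :=
      Multiset.map_congr rfl (fun β _ => by simp)
    rw [this, Multiset.map_const', Multiset.sum_replicate, smul_eq_mul, mul_one, hBcard]
  obtain ⟨i, hi⟩ := exists_node_eval_ge hD1 hφ0 hφ W hWmonic hWdeg
  refine ⟨node φ D i, node_mem hφ0.le hD1 i, ?_⟩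
  have hz1 : ‖arc (node φ D i)‖ = 1 := norm_arc _
  -- ‖W(z)‖ = Π ‖z − refl β‖
  have hWev : ‖W.eval (arc (node φ D i))‖ = (B.map (fun β => ‖arc (node φ D i) - refl β‖)).prod := by
    rw [hWdef, eval_multiset_prod, Multiset.map_map, norm_multiset_prod_map]
    congr 1
    exact Multiset.map_congr rfl (fun β _ => by simp)
  have h1 : (B.map (fun β => ‖arc (node φ D i) - refl β‖ * Real.sqrt ‖β‖)).prod
      ≤ (B.map (fun γ => ‖arc (node φ D i) - γ‖)).prod :=
    multiset_prod_map_le B _ _ (fun β _ => by positivity)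
      (fun β hβ => norm_sub_refl_mul_sqrt_le hz1 (hBne β hβ))
  rw [Multiset.prod_map_mul, ← hWev] at h1
  have h2 : 0 ≤ (B.map (fun γ => Real.sqrt ‖γ‖)).prod := multiset_prod_map_nonneg B _ (fun _ _ => Real.sqrt_nonneg _)
  calc (2 * φ / (Real.pi * D)) ^ D * (D.factorial : ℝ) / (D + 1) * (B.map (fun γ => Real.sqrt ‖γ‖)).prod
      ≤ ‖W.eval (arc (node φ D i))‖ * (B.map (fun γ => Real.sqrt ‖γ‖)).prod :=
        mul_le_mul_of_nonneg_right hi h2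
    _ ≤ (B.map (fun γ => ‖arc (node φ D i) - γ‖)).prod := h1

end Summit.ValiantsHypothesis.ValiantsHypothesis.Theorems.LacunarySymmetroidMatrixDescartes.Defect
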